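/-
Copyright (c) 2026. All rights reserved.
Released under Apache 2.0 license as described in the file LICENSE.
-/
import Literature.NumberTheory.Automorphic.GodementHeightFloor
import Literature.NumberTheory.Automorphic.MahlerCriterionGLn
import Literature.Topology.Algebra.StabilizerDescent
import HarnessLib

/-!
# Compactness of `U(H)(L⁺)\U(H)(𝔸_{L⁺})` for an anisotropic hermitian form (Godement's criterion)

For a CM field `L`, `H ∈ M_n(L)` and the CM conjugation `c`, if the hermitian form
`⟪x, y⟫ = (c x)ᵀ H y` is **anisotropic** over `L` (`⟪x, x⟫ = 0 ⇒ x = 0`), then the adelic quotient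
`U(H)(L⁺)\U(H)(𝔸_{L⁺})` (`adelicUnitaryGroup L H ⧸ adelicUnitaryRat L H` of the tree's
`AdelicUnitaryGroup`) is compact (`compactSpace_adelicUnitaryQuot`).

The argument is the Mostow–Tamagawa / Godement proof of the compactness criterion (R. Godement,
*Domaines fondamentaux des groupes arithmétiques*, Sém. Bourbaki 257 (1962/63), §§ 1–4, Thm. 4.2;
A. Borel, *Introduction aux groupes arithmétiques* (1969), § 8; Platonov–Rapinchuk (1994), Thm. 5.5
and § 5.3), assembled from kernel-checked tree pieces:

1. **Mahler's criterion on `GL_n(𝔸_L)`** (`MahlerCriterionGLn`): a subset of `GL_n(𝔸_L)` on which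
   `|det|_𝔸` is bounded and the heights `h(g ξ)`, `ξ ∈ Lⁿ ∖ 0`, are bounded away from `0` lies in
   `C · GL_n(L)` with `C` compact.
2. **Heights are bounded below on `U(H)(𝔸)`** (§ 4): for `g ∈ U(H)(𝔸)` and `ξ ∈ Lⁿ ∖ 0`,
   `q = ⟪ξ, ξ⟫ ∈ L×` (anisotropy), `|q|_𝔸 = 1` (product formula), and `q = ⟪g ξ, g ξ⟫`, so the
   fundamental inequality `|xᵀ y|_𝔸 ≤ h(x) h(y)` (`AdelicVectorHeightPairing`) and the Galois
   invariance of heights `h(c x) = h(x)` (`AdelicVectorHeightGalois`) give a uniform floor.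
3. **`|det g|_𝔸 = 1` on `U(H)(𝔸)`** (§ 4): `c(det g) · det H · det g = det H`, `det H ≠ 0`, and
   `|c a|_𝔸 = |a|_𝔸`.
4. **Descent from `GL_n` to the stabiliser** (`Literature.Topology.Algebra.StabilizerDescent`, the
   abstract Mostow–Tamagawa lemma) for the right action `X · g = (c g)ᵀ X g` of `GL_n(𝔸_L)` on
   `M_n(𝔸_L)`, whose stabiliser at `H_𝔸` is `U(H)(𝔸)`, with `Γ = GL_n(L)` and `D = M_n(L)`.
5. `U(H)(𝔸) ∩ GL_n(L) = U(H)(L⁺)`, so the compact set surjects onto the quotient.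

## Provenance

LEAN-IN-TREE migration (class L) of §§ 5–6 of the Hodge-CM cell package module
`HodgeCM/PerL34/GodementCompact.lean` (expansion seat pv10-g4, 2026-08-18), verbatim modulo the
namespace (`HodgeCM.PerL34.Godement` ↦ `Literature.NumberTheory.Automorphic.Godement`), the
re-basing on the tree's `AdelicUnitaryGroup` (`conjRingHomK ↦ cmConjRingHom`), `StabilizerDescent`,
`AdelicVectorHeightGalois`, `MahlerCriterionGLn` (`glTranspose ↦ transposeGL`); § 1 is the separate
tree file `AdelicVectorHeightPairing`, §§ 2–4 are `GodementHeightFloor`. The package's S-side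
corollary `printFact_unitaryCompact_holds` is not part of this file.
-/

set_option autoImplicit false

noncomputable section

open scoped NNReal Matrix Pointwise MatrixGroups
open NumberField IsDedekindDomain

namespace Literature.NumberTheory.Automorphic.Godement

open Literature.AlgebraicGeometry.ShimuraVarieties
open Literature.Topology.Algebra

section CMField

variable (L : Type) [Field L] [NumberField L] [IsCMField L]
variable {n : Type} [Fintype n] [DecidableEq n]

local notation "𝔸L" => AdeleRing (𝓞 L) L
/-! ## §5 The descent data: `X · g = (c g)ᵀ X g` on `M_n(𝔸_L)` -/

/-- The right action `X · g = (c g)ᵀ · X · g` of `GL_n(𝔸_L)` on `M_n(𝔸_L)`. [folklore] -/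
def conjAct : RightActionData (GL n 𝔸L) (Matrix n n 𝔸L) where
  act X g := (((g : Matrix n n 𝔸L).map (adeleConj L))ᵀ * X) * (g : Matrix n n 𝔸L)
  act_mul X g h := by
    simp only [Units.val_mul, Matrix.map_mul, Matrix.transpose_mul, Matrix.mul_assoc]
  act_one X := by
    simp only [Units.val_one, Matrix.map_one (adeleConj L) (map_zero _) (map_one _),
      Matrix.transpose_one, Matrix.one_mul, Matrix.mul_one]

/-- Unfolding of the conjugation action `X · g = (c g)ᵀ X g`. [folklore] -/
theorem conjAct_act (X : Matrix n n 𝔸L) (g : GL n 𝔸L) :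
    (conjAct L).act X g = (((g : Matrix n n 𝔸L).map (adeleConj L))ᵀ * X) * (g : Matrix n n 𝔸L) :=
  rfl

/-- The stabiliser of `H_𝔸` is the adelic unitary group `U(H)(𝔸_{L⁺})`. [folklore] -/
theorem stabilizer_conjAct (H : Matrix n n L) :
    (conjAct L).stabilizer (H.map (algebraMap L 𝔸L)) = adelicUnitaryGroup L H :=
  Subgroup.ext fun g => by
    rw [RightActionData.mem_stabilizer_iff, mem_adelicUnitaryGroup_iff, conjAct_act]

/-- `g ↦ (c g)ᵀ X g` is continuous on `GL_n(𝔸_L)`. [folklore] -/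
theorem continuous_conjAct (X : Matrix n n 𝔸L) :
    Continuous fun g : GL n 𝔸L => (conjAct L).act X g := by
  have hval : Continuous fun g : GL n 𝔸L => (g : Matrix n n 𝔸L) := Units.continuous_val
  simp only [conjAct_act]
  exact ((hval.matrix_map (continuous_adeleConj L)).matrix_transpose.matrix_mul
    continuous_const).matrix_mul hval

/-- The matrices with principal entries `M_n(L) ⊂ M_n(𝔸_L)`. [folklore] -/
def principalMatrices : Set (Matrix n n 𝔸L) :=
  {X | ∀ i j, X i j ∈ AdeleRing.principalSubgroup (𝓞 L) L}

omit [IsCMField L] [Fintype n] [DecidableEq n] in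
/-- `M_n(L)` is closed in `M_n(𝔸_L)` (a discrete subgroup of a Hausdorff group is closed).
[folklore] -/
theorem isClosed_principalMatrices : IsClosed (principalMatrices L (n := n)) := by
  haveI := AdeleRing.discreteTopology_principalSubgroup L
  haveI := t2Space_adeleRing_of_numberField L
  have hP : IsClosed (AdeleRing.principalSubgroup (𝓞 L) L : Set 𝔸L) :=
    AddSubgroup.isClosed_of_discrete
  have hD : principalMatrices L (n := n) =
      ⋂ i, ⋂ j, (fun X : Matrix n n 𝔸L => X i j) ⁻¹'
        (AdeleRing.principalSubgroup (𝓞 L) L : Set 𝔸L) := by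
    ext X
    simp only [principalMatrices, Set.mem_setOf_eq, Set.mem_iInter, Set.mem_preimage,
      SetLike.mem_coe]
  rw [hD]
  exact isClosed_iInter fun i => isClosed_iInter fun j =>
    hP.preimage (continuous_id.matrix_elem i j)

omit [IsCMField L] [DecidableEq n] in
/-- `M_n(L)` is discrete in `M_n(𝔸_L)`. [folklore] -/
theorem discreteTopology_principalMatrices : DiscreteTopology (principalMatrices L (n := n)) := by
  haveI := AdeleRing.discreteTopology_principalSubgroup L
  let e : principalMatrices L (n := n) → Matrix n n (AdeleRing.principalSubgroup (𝓞 L) L) :=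
    fun X i j => ⟨X.1 i j, X.2 i j⟩
  have hcont : Continuous e :=
    continuous_pi fun i => continuous_pi fun j =>
      ((continuous_subtype_val.matrix_elem i j).subtype_mk _)
  have hinj : Function.Injective e := by
    intro X Y h
    apply Subtype.ext
    ext i j
    exact congrArg Subtype.val (congrFun (congrFun h i) j)
  exact DiscreteTopology.of_continuous_injective hcont hinj

omit [IsCMField L] [DecidableEq n] in
/-- `M_n(L)` meets every compact subset of `M_n(𝔸_L)` in a finite set. [folklore] -/
theorem finite_inter_principalMatrices {C : Set (Matrix n n 𝔸L)} (hC : IsCompact C) :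
    (C ∩ principalMatrices L (n := n)).Finite := by
  have hKD : IsCompact (C ∩ principalMatrices L (n := n)) :=
    hC.inter_right (isClosed_principalMatrices L)
  haveI := discreteTopology_principalMatrices L (n := n)
  exact hKD.finite (isDiscrete_iff_discreteTopology.mpr
    (DiscreteTopology.of_subset ‹_› Set.inter_subset_right))

omit [IsCMField L] in
/-- `toAdeleGL` is `GL_n` of the diagonal embedding (definitional). [folklore] -/
theorem toAdeleGL_eq_map (g : GL n L) :
    toAdeleGL L g = Matrix.GeneralLinearGroup.map (algebraMap L 𝔸L) g :=
  Units.ext rfl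

omit [Fintype n] [DecidableEq n] in
/-- Conjugating the base change of a rational matrix: `c(g_𝔸) = (c g)_𝔸`. [folklore] -/
theorem map_map_adeleConj (g : Matrix n n L) :
    (g.map (algebraMap L 𝔸L)).map (adeleConj L) =
      (g.map (cmConjRingHom L)).map (algebraMap L 𝔸L) := by
  rw [Matrix.map_map, Matrix.map_map]
  exact congrArg _ (funext fun x => adeleConj_algebraMap L x)

/-- `H_𝔸 · γ ∈ M_n(L)` for rational `γ`. [folklore] -/
theorem conjAct_toAdeleGL_mem (H : Matrix n n L) (g : GL n L) :
    (conjAct L).act (H.map (algebraMap L 𝔸L)) (toAdeleGL L g) ∈ principalMatrices L (n := n) := by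
  have hact : (conjAct L).act (H.map (algebraMap L 𝔸L)) (toAdeleGL L g) =
      ((((g : Matrix n n L).map (cmConjRingHom L))ᵀ * H) * (g : Matrix n n L)).map
        (algebraMap L 𝔸L) := by
    rw [conjAct_act, val_toAdeleGL, map_map_adeleConj, ← Matrix.transpose_map, ← Matrix.map_mul,
      ← Matrix.map_mul]
  intro i j
  rw [hact]
  exact ⟨_, rfl⟩

/-- **`U(H)(𝔸) ∩ GL_n(L) = U(H)(L⁺)`**: an adelic unitary matrix with rational entries is a
rational unitary matrix (entrywise injectivity of `L → 𝔸_L`). [folklore] -/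
theorem mem_adelicUnitaryRat_of_eq_toAdeleGL (H : Matrix n n L) {γ : GL n 𝔸L}
    (hγU : γ ∈ adelicUnitaryGroup L H) {g : GL n L} (hg : toAdeleGL L g = γ) :
    (⟨γ, hγU⟩ : adelicUnitaryGroup L H) ∈ adelicUnitaryRat L H := by
  rw [mem_adelicUnitaryRat_iff]
  refine ⟨g, ?_, hg⟩
  rw [mem_unitaryGroup_iff]
  have hγ := (mem_adelicUnitaryGroup_iff L H γ).mp hγU
  rw [← hg, val_toAdeleGL, map_map_adeleConj, ← Matrix.transpose_map, ← Matrix.map_mul,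
    ← Matrix.map_mul] at hγ
  haveI : Nontrivial 𝔸L :=
    inferInstanceAs (Nontrivial (InfiniteAdeleRing L × FiniteAdeleRing (𝓞 L) L))
  exact Matrix.map_injective (algebraMap L 𝔸L).injective hγ

/-! ## §6 Compactness of `U(H)(L⁺)\U(H)(𝔸_{L⁺})` -/

/-- **Godement's compactness criterion for anisotropic unitary groups (KERNEL).**  For a CM field
`L`, `H ∈ M_k(L)` and the CM conjugation `c`, if `⟪x, x⟫_H = (c x)ᵀ H x = 0 ⇒ x = 0` on `Lᵏ`, then
`U(H)(L⁺)\U(H)(𝔸_{L⁺})` is compact (Borel–Harish-Chandra 1962 / Mostow–Tamagawa 1962 /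
Godement, Sém. Bourbaki 257, Thm. 4.2, for the anisotropic group `U(H)`; Margulis 1991, Ch. I
Thm. 3.2.1(b)). [folklore] -/
theorem compactSpace_adelicUnitaryQuot {k : ℕ} (H : Matrix (Fin k) (Fin k) L)
    (hanis : ∀ x : Fin k → L, hermForm (cmConjRingHom L) H x x = 0 → x = 0) :
    CompactSpace (adelicUnitaryGroup L H ⧸ adelicUnitaryRat L H) := by
  obtain ⟨c, hc, hfloor⟩ := exists_vecHeight_floor L H hanis
  have hdet : H.det ≠ 0 := det_ne_zero_of_anisotropic L H hanis
  -- Mahler: `U(H)(𝔸) ⊆ C · GL_k(L)`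
  obtain ⟨C, hC, hCmul⟩ := Mahler.exists_isCompact_mul_rational k L c 1 hc
  have hUΓ : ∀ g ∈ adelicUnitaryGroup L H,
      g ∈ C * (rationalPointsGL k L : Set (GL (Fin k) 𝔸L)) := fun g hg =>
    hCmul g (hfloor g hg) (ideleNorm_det_eq_one L H hdet hg).le
  -- descent: `U(H)(𝔸) ⊆ C' · (U(H)(𝔸) ∩ GL_k(L))`, `C' ⊆ U(H)(𝔸)` compact
  have hstab := stabilizer_conjAct L H
  obtain ⟨C', hC', hC'U, hdesc⟩ := (conjAct L).exists_isCompact_descent (H.map (algebraMap L 𝔸L))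
    (continuous_conjAct L _) (by rw [hstab]; exact isClosed_adelicUnitaryGroup L H)
    (rationalPointsGL k L) (principalMatrices L)
    (fun γ hγ => by
      obtain ⟨g, rfl⟩ := MonoidHom.mem_range.mp hγ
      rw [← toAdeleGL_eq_map]
      exact conjAct_toAdeleGL_mem L H g)
    (fun K hK => finite_inter_principalMatrices L hK) hC
  rw [hstab] at hC'U hdesc
  -- the compact set `C' ∩ U(H)(𝔸)` of the subtype surjects onto the quotient
  have hemb : Topology.IsClosedEmbedding
      (Subtype.val : adelicUnitaryGroup L H → GL (Fin k) 𝔸L) :=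
    (isClosed_adelicUnitaryGroup L H).isClosedEmbedding_subtypeVal
  have hK : IsCompact (Subtype.val ⁻¹' C' : Set (adelicUnitaryGroup L H)) :=
    hemb.isCompact_preimage hC'
  have himg : (QuotientGroup.mk :
      adelicUnitaryGroup L H → adelicUnitaryGroup L H ⧸ adelicUnitaryRat L H) ''
      (Subtype.val ⁻¹' C') = Set.univ := by
    refine Set.eq_univ_of_forall fun x => ?_
    induction x using QuotientGroup.induction_on with
    | H u =>
      obtain ⟨c', hc', γ, ⟨hγU, hγΓ⟩, hcγ⟩ := Set.mem_mul.mp (hdesc u u.2 (hUΓ u u.2))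
      obtain ⟨g, hg⟩ := MonoidHom.mem_range.mp hγΓ
      rw [← toAdeleGL_eq_map] at hg
      refine ⟨⟨c', hC'U hc'⟩, hc', ?_⟩
      apply QuotientGroup.eq.mpr
      have hγeq : (⟨c', hC'U hc'⟩ : adelicUnitaryGroup L H)⁻¹ * u = ⟨γ, hγU⟩ := by
        apply Subtype.ext
        change c'⁻¹ * (u : GL (Fin k) 𝔸L) = γ
        rw [← hcγ, inv_mul_cancel_left]
      rw [hγeq]
      exact mem_adelicUnitaryRat_of_eq_toAdeleGL L H hγU hg
  refine ⟨?_⟩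
  rw [← himg]
  exact hK.image QuotientGroup.continuous_mk

end CMField

end Literature.NumberTheory.Automorphic.Godement
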